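import Summits.BirchSwinnertonDyer.BirchSwinnertonDyer.Theorems.OneSidedTwistSqueezeX9KatoDivisibilityX9StubTestCocyclePkLevelX9Principal
import Summits.BirchSwinnertonDyer.BirchSwinnertonDyer.Theorems.OneSidedTwistSqueezeX9KatoDivisibilityX9LocalPEnginePk
import Summits.BirchSwinnertonDyer.BirchSwinnertonDyer.Theorems.OneSidedTwistSqueezeX9KatoDivisibilityX9LocalExponentPkUniform
import Summits.BirchSwinnertonDyer.BirchSwinnertonDyer.Theorems.OneSidedTwistSqueezeX9KatoDivisibilityX9StubTestPairSupplyPkX9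
import Summits.BirchSwinnertonDyer.BirchSwinnertonDyer.Theorems.SmallImageMuTransferMuTransferX9KolyvaginClassTwistUnramified
import Summits.BirchSwinnertonDyer.BirchSwinnertonDyer.Theorems.SmallImageMuTransferMuTransferX9TorsionUnramifiedOutside
import Summits.BirchSwinnertonDyer.BirchSwinnertonDyer.Theorems.SmallImageMuTransferMuTransferX9SelmerDualTotallyRamified
import Literature.NumberTheory.GaloisCohomology.PoitouTate
import Literature.NumberTheory.GaloisRepresentations.LocalEulerPoincareCharacteristic
import HarnessLib

/-!
# Crux `KatoDivisibilityX9` (stmt-BirchSwinnertonDyer-20547), line `graded_euler_loss`: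
# STUB 1a′ `stub_testCocyclePkLevelX9` — the level-`p^{d+1}` TEST COCYCLE, ASSEMBLED

Seat `bsd-line-k6-p4` (prover-bsd-line-k6-p4-g6-0, stub worker 1a′, wave 1b).  THEOREMS ONLY (no
definition, no named fact, no `sorry`); `--supports stmt-BirchSwinnertonDyer-20547` (stub credit for the
registered stub `stub_testCocyclePkLevelX9` of the lead's skeleton
`Cruxes/KatoDivisibilityX9/Lines/graded_euler_loss.lean`, whose signature is reproduced VERBATIM below).

From a test pair `(y, t)` over `ℚ_∞` — `y ∈ H¹(ℚ_∞, E[p])`, `t ∈ Sel₀(ℚ_∞, E[p^∞])`, `ι_N y = p^d t`,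
`(conj_γ − 1)^L t = 0`, `(conj_γ − 1)^J y ≠ 0`, `J + 1 ≤ L` — the stub asks for classes
`Ψ ∈ H¹(ℚ, 𝒯^{(d+1)}_L(E, κ⁻¹))`, `ψ̄ ∈ H¹(ℚ, 𝒯_L(E[p], κ⁻¹))` with (1) `p^d Ψ = ι_* ψ̄`, (2) `T^J ψ̄ ≠ 0`,
(3) `Ψ` unramified off a finite `S ⊇ S₀`, (4) `loc_v (T^ε Ψ) = 0` for `v ∈ S`, where `ε` and `S` are chosen
BEFORE `L, J, y`.  The assembly:

* (1)+(2) and the coordinate cocycles `e_0, …, e_{L−1} ∈ Z¹(Γ_∞, E[p^{d+1}])` of a cocycle `ψ` of `Ψ`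
  (`ψ(τ)_i = e_i(τ)` on `Γ_∞`, `e_i = γ·e_{i+1} − e_{i+1}`, `ι_*[e_i] = (conj_γ − 1)^{L−1−i} t` FINE) —
  `…StubTestCocyclePkLevelX9Core.exists_testCocycle_algebraic` (its no-fixed-torsion hypothesis holds on
  X9 rows: `E[p]` irreducible, `p` odd, `ℚ_∞/ℚ` abelian — `GaloisImage.geomPoints_eq_zero_of_fixed_of_pow_smul_eq_zero`).
* `S := S₀ ∪ {bad places} ∪ {v ∣ p}` (`TorsionUnramified.exists_finite_superset_isUnramifiedAt_torsionGaloisModule`).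
* (3) off `S`: `I_{𝔓₀(v)} ≤ Γ_∞` (`ℤ_p`-extensions are unramified outside `p`), every `e_i` is principal
  on `Γ_∞ ∩ D_v` over `E[p^∞]` (fine condition) and vanishes on `I_{𝔓₀(v)}` (Néron–Ogg–Shafarevich,
  `…Principal.apply_eq_zero_of_mem_inertia`), so `ψ` vanishes on `I_{𝔓₀(v)}` and `loc_v Ψ` is unramified
  (`KolyvaginTwist.localization_mem_unramifiedSubgroup_of_forall_inertia_apply_eq_zero`).
* (4) at `v ∈ S`, `v ∤ p`: the UNIFORM local exponent `ε_u` of `…LocalExponentPkUniform` (every class).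
* (4) at the place `v₀ ∋ p` (`exists_localization_shiftH1Pk_iterate_eq_zero_of_mem`): total ramification
  gives `γ = d·u₀`, `d ∈ D_{v₀}`, `u₀ ∈ Γ_∞`, and `d⁻¹ ∈ D_{v₀}` a topological generator of `κ⁻¹`; the
  DEFECT bound `N₀` of `…Principal.exists_principalBound` makes `e_i` principal on `D_{v₀} ∩ Γ_∞` for
  `L − 1 − i ≥ N₀` (input: the bottom class `[γ·e_0 − e_0] = (conj_γ − 1)^L ι_*^{-1} t = 0`), hence the
  shifted cocycle `S^{N₀ + j} ψ` is principal there (`…Principal.shiftPowCocyclePk_principal`) and the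
  level-`p^k` ENGINE `…LocalPEnginePk.localization_shiftH1Pk_iterate_modPkTwist_invTwist_eq_zero_of_principal`
  kills `T^b` of its class at `v₀`, `p^b ≥ #E[p^{d+1}]`: `loc_{v₀} (T^m Ψ) = 0` for all `m ≥ N₀ + b`.
* `ε := max ε_u (N₀ + b)`; the stub's `twistModPkShiftEmbed ∘ twistModPkTruncate` spelling of `T^ε` is
  `…LocalExponentPkUniform.map_twistModPkShiftEmbed_map_twistModPkTruncate_eq_shiftH1Pk_iterate`.

The two named-fact binders of the stub (local Euler–Poincaré characteristic, Poitou–Tate) are not used.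
BSD is not proved by any of this; no summit statement is proved by this seat.

References: K. Kato, Astérisque 295 (2004) §13.8 [Kato2004Asterisque]; R. Greenberg, LNM 1716 (1999) §3
[GreenbergLNM1716]; J.-P. Serre, *Galois Cohomology* (1997) I §2.5, I §5.1 [SerreGaloisCohomology1997];
L. Washington, GTM 83 (1997) Prop. 13.2–13.3, §13.1–13.2 [Washington1997]; J. S. Milne, *Arithmetic Duality
Theorems* (2006) I §2 [MilneADT2006]; J. H. Silverman, *AEC* VII.4.1 [SilvermanAEC2009].
-/

set_option autoImplicit false
-- the summit and its single problem are both named `BirchSwinnertonDyer` (registry layout D-0017)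
set_option linter.dupNamespace false

noncomputable section

open scoped NumberField ContRepresentation
open Field IsDedekindDomain NumberField
open Literature.NumberTheory.GaloisRepresentations Literature.NumberTheory.GaloisCohomology
  Literature.NumberTheory.EllipticCurves
open Literature.NumberTheory.EllipticCurves.GreenbergSelmer (decomp)
open WeierstrassCurve (geomTorsion geomPrimaryTorsion geomPoints)
open Summit.BirchSwinnertonDyer.BirchSwinnertonDyer.Rank1Residual
open Summit.BirchSwinnertonDyer.BirchSwinnertonDyer.Theorems.OneSidedTwistSqueezeX9KatoDivisibilityX9StubTestCocyclePkLevelX9Kummer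
open Summit.BirchSwinnertonDyer.BirchSwinnertonDyer.Theorems.OneSidedTwistSqueezeX9KatoDivisibilityX9StubTestCocyclePkLevelX9Core
open Summit.BirchSwinnertonDyer.BirchSwinnertonDyer.Theorems.OneSidedTwistSqueezeX9KatoDivisibilityX9StubTestCocyclePkLevelX9Principal
open Summit.BirchSwinnertonDyer.BirchSwinnertonDyer.Theorems.OneSidedTwistSqueezeX9KatoDivisibilityX9LocalPEnginePk
open Summit.BirchSwinnertonDyer.BirchSwinnertonDyer.Theorems.OneSidedTwistSqueezeX9KatoDivisibilityX9LocalExponentPkUniform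

namespace Summit.BirchSwinnertonDyer.BirchSwinnertonDyer.Theorems.OneSidedTwistSqueezeX9KatoDivisibilityX9StubTestCocyclePkLevelX9

/-! ## The clause at `p`, uniformly in the level -/

/-- **The local condition at the place above `p`, with ONE exponent for all levels.**  For `κ`
cyclotomic over `ℚ` with topological generator `γ` there is `N_p` (depending on `W, p, k, κ, γ` only)
such that at every place `v ∋ p`, for every level `L ≥ 1`, every cocycle `ψ` of
`𝒯^{(k)}_L(E, κ⁻¹) = W.modPkTwist p k κ.invTwist L` whose coordinate cocycles `e_i` on `Γ_∞` satisfy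
`e_i = γ·e_{i+1} − e_{i+1}`, whose top member `e_{L−1}` is principal on `Γ_∞ ∩ D_v` over `E[p^∞]`, and
whose bottom member has `[γ·e_0 − e_0] = 0`, and every `m ≥ N_p`: `loc_v (T^[m] [ψ]) = 0`.
(`v` is THE place above `p`; `γ = d·u₀` with `d ∈ D_v`, `u₀ ∈ Γ_∞` by total ramification, `d⁻¹ ∈ D_v`
generates `κ⁻¹` topologically; `N_p := N₀ + #E[p^k]` with `N₀` the principality bound of
`…Principal.exists_principalBound`: `S^{m − b} ψ` is principal on `D_v ∩ Γ_∞` and the engine of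
`…LocalPEnginePk` kills `T^b` of its class at `v`, `b = #E[p^k] ≤ p^b`.)
[cite: GreenbergLNM1716, §3 Lemma 3.1] [cite: Washington1997, Prop. 13.2–13.3]
[cite: SerreGaloisCohomology1997, I §5.1] -/
theorem exists_localization_shiftH1Pk_iterate_eq_zero_of_mem (W : WeierstrassCurve ℚ) [W.IsElliptic]
    (p : ℕ) [Fact p.Prime] (k : ℕ) (κ : ZpExtension ℚ p) (hκ : κ.IsCyclotomic)
    {γ : absoluteGaloisGroup ℚ} (hγ : κ.IsTopGenerator γ) :
    ∃ Np : ℕ, ∀ (v : HeightOneSpectrum (𝓞 ℚ)), (p : 𝓞 ℚ) ∈ v.asIdeal →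
      ∀ (L : ℕ) (hL : 0 < L) (ψ : contOneCocycles (W.modPkTwist p k κ.invTwist L).toTopRep)
        (e : Fin L → contOneCocycles (discreteTopRep κ.kerSubgroup (geomTorsion W ((p : ℤ) ^ k)))),
        (∀ (τ : κ.kerSubgroup) (i : Fin L), ψ.1 (τ : absoluteGaloisGroup ℚ) i = (e i).1 τ) →
        (∀ (i : Fin L) (hi : (i : ℕ) + 1 < L),
          e i = conjCocycle κ.kerSubgroup γ (e ⟨(i : ℕ) + 1, hi⟩) - e ⟨(i : ℕ) + 1, hi⟩) →
        (∃ a : geomPrimaryTorsion W p,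
          ∀ (u : absoluteGaloisGroup ℚ) (hu : u ∈ κ.kerSubgroup ⊓ decomp v),
            AddSubgroup.inclusion (pkTorsion_le_geomPrimaryTorsion W p k)
              ((e ⟨L - 1, by omega⟩).1 ⟨u, hu.1⟩) = u • a - a) →
        oneCocycleClass _ (conjCocycle κ.kerSubgroup γ (e ⟨0, hL⟩) - e ⟨0, hL⟩) = 0 →
        ∀ m : ℕ, Np ≤ m →
          galoisCohomology.localization (W.modPkTwist p k κ.invTwist L) (Sum.inr v) 1
            ((κ.invTwist.shiftH1Pk (W.torsionGaloisModule ((p : ℤ) ^ k))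
              (W.pow_nsmul_geomTorsion_eq_zero p k) L)^[m] (oneCocycleClass _ ψ)) = 0 := by
  have hp : p.Prime := Fact.out
  by_cases hex : ∃ v₀ : HeightOneSpectrum (𝓞 ℚ), (p : 𝓞 ℚ) ∈ v₀.asIdeal
  swap
  · exact ⟨0, fun v hv => absurd ⟨v, hv⟩ hex⟩
  obtain ⟨v₀, hv₀⟩ := hex
  -- total ramification at `p`: `γ = d · (d⁻¹ γ)` with `d ∈ D_{v₀}`, `d⁻¹ γ ∈ Γ_∞`
  obtain ⟨d, hdD, hdγ⟩ := SelmerDual.exists_mem_decomp_inv_mul_mem_kerSubgroup κ hκ v₀ hv₀ γ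
  -- `d⁻¹ ∈ D_{v₀}` is a topological generator of `κ⁻¹`
  have hκd : κ d = Multiplicative.ofAdd 1 := by
    have h1 : κ (d⁻¹ * γ) = 1 := hdγ
    rw [map_mul, map_inv, inv_mul_eq_one] at h1
    exact h1 ▸ hγ
  have hgen : κ.invTwist.IsTopGenerator d⁻¹ := by
    unfold ZpExtension.IsTopGenerator
    apply Multiplicative.toAdd.injective
    rw [ZpExtension.toAdd_invTwist_apply, map_inv, toAdd_inv, neg_neg, hκd]
  -- the principality bound `N₀` (part 6) and the fixed-point bound `#E[p^k] ≤ p^b`, `b := #E[p^k]`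
  obtain ⟨N₀, hN₀⟩ := exists_principalBound W p k κ (decomp v₀) hdD hdγ (mul_inv_cancel_left d γ)
  haveI : Finite (geomTorsion W ((p : ℤ) ^ k)) :=
    WeierstrassCurve.finite_torsionPoints_holds W (AlgebraicClosure ℚ)
      (pow_ne_zero _ (by exact_mod_cast hp.ne_zero))
  have hb : Nat.card {P : geomTorsion W ((p : ℤ) ^ k) //
      ∀ u ∈ decomp v₀ ⊓ κ.invTwist.kerSubgroup, W.torsionGaloisModule ((p : ℤ) ^ k) u P = P} ≤
      p ^ Nat.card (geomTorsion W ((p : ℤ) ^ k)) :=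
    (Finite.card_subtype_le _).trans (Nat.lt_pow_self hp.one_lt).le
  refine ⟨N₀ + Nat.card (geomTorsion W ((p : ℤ) ^ k)), ?_⟩
  intro v hv L hL ψ e hψe he htop hbot m hm
  -- `v = v₀`: `ℚ` has one place above `p`
  have hvv : v = v₀ :=
    (Rat.HeightOneSpectrum.primesEquiv (R := 𝓞 ℚ)).injective (Subtype.ext
      ((SelmerDual.primesEquiv_eq_of_natCast_mem hv).trans
        (SelmerDual.primesEquiv_eq_of_natCast_mem hv₀).symm))
  subst v
  -- every `e_i` with `L − 1 − i ≥ N₀` is principal on `D_v ∩ Γ_∞` over `E[p^k]`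
  obtain ⟨a, ha⟩ := htop
  have hP := hN₀ L hL e he ⟨a, fun u hu => ha u ⟨hu.2, hu.1⟩⟩ hbot
  -- the shifted cocycle `S^{m−b} ψ` is principal on `D_v ∩ ker κ⁻¹`; the engine kills `T^b` of its class
  have hΦ := shiftPowCocyclePk_principal W p k κ L (decomp v₀) ψ e hψe hP
    (m := m - Nat.card (geomTorsion W ((p : ℤ) ^ k))) (by omega)
  have key := localization_shiftH1Pk_iterate_modPkTwist_invTwist_eq_zero_of_principal W p k κ L v₀
    (inv_mem hdD) hgen hb _ hΦ
  rw [← ZpExtension.shiftH1Pk_iterate_oneCocycleClass, ← Function.iterate_add_apply,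
    Nat.add_sub_of_le (by omega : Nat.card (geomTorsion W ((p : ℤ) ^ k)) ≤ m)] at key
  exact key

/-! ## The registered stub -/

set_option maxHeartbeats 400000 in
/-- **STUB 1a′ of line `graded_euler_loss` (skeleton v4.1) — the level-`p^{d+1}` TEST COCYCLE at an honest
level `L`, VERBATIM the registered signature (= hypothesis `hG1` of
`…GradedCoreAssemblyDefect.fineCoreGraded_of_supply_of_testCocycle_of_kolyvaginPrime_of_reciprocity`).**
From a test pair `(y, t)` (`ι_N y = p^d t`, `t ∈ Sel₀(ℚ_∞, E[p^∞])`, `(conj_γ − 1)^L t = 0`,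
`(conj_γ − 1)^J y ≠ 0`, `J + 1 ≤ L`): `Ψ ∈ H¹(ℚ, 𝒯^{(d+1)}_L(E, κ⁻¹))`, `ψ̄ ∈ H¹(ℚ, 𝒯_L(E[p], κ⁻¹))` with
`p^d Ψ = ι_* ψ̄`, `T^J ψ̄ ≠ 0`, `Ψ` unramified outside `S`, `loc_v (T^ε Ψ) = 0` for `v ∈ S` — with `ε`, `S`
depending on `W, p, κ, γ, d, S₀` only (see the module docstring for the assembly; the two named-fact
binders are unused). [cite: Kato2004Asterisque, §13.8 (pp. 228–229)] [cite: GreenbergLNM1716, §3 Lemma 3.1]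
[cite: MilneADT2006, Ch. I §2] [cite: Washington1997, Prop. 13.2–13.3] -/
theorem stub_testCocyclePkLevelX9 : ∀ (W : WeierstrassCurve ℚ) [W.IsElliptic] [W.IsGloballyMinimal] (p : ℕ) [Fact p.Prime]
      (κ : ZpExtension ℚ p) (γ : absoluteGaloisGroup ℚ),
      p ≠ 2 → W.HasIrreducibleModPGaloisRep p → ¬ W.HasSurjectiveModNGaloisRep p →
      κ.IsCyclotomic → κ.IsTopGenerator γ →
      (∀ v : HeightOneSpectrum (𝓞 ℚ), localEulerPoincareCharacteristic (v.adicCompletion ℚ)) →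
      poitouTate_sum_localTatePairing_eq_zero ℚ →
      ∀ (d : ℕ)
        (ι : (W.torsionGaloisModule (p : ℤ)).toContRepresentation →ⁱL
          (W.torsionGaloisModule ((p : ℤ) ^ (d + 1))).toContRepresentation),
        (∀ P : geomTorsion W (p : ℤ),
          ((ι P : geomTorsion W ((p : ℤ) ^ (d + 1))) : geomPoints W) = (P : geomPoints W)) →
      ∀ (S₀ : Set (HeightOneSpectrum (𝓞 ℚ))), S₀.Finite →
      ∃ (ε : ℕ) (S : Set (HeightOneSpectrum (𝓞 ℚ))), S.Finite ∧ S₀ ⊆ S ∧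
        ∀ (L J : ℕ) (y : Literature.NumberTheory.EllipticCurves.subgroupH1 κ.kerSubgroup
            (geomTorsion W (p : ℤ))), J + 1 ≤ L →
          (∃ t : W.fineSelmerInfty κ,
            W.torsionToPrimaryH1Sub p κ.kerSubgroup y = p ^ d • (t : W.subgroupH1 p κ.kerSubgroup) ∧
            (⇑(W.conjH1 p κ.kerSubgroup γ - AddMonoidHom.id (W.subgroupH1 p κ.kerSubgroup)))^[L]
              (t : W.subgroupH1 p κ.kerSubgroup) = 0) →
          (⇑(Literature.NumberTheory.EllipticCurves.conjH1 κ.kerSubgroup (geomTorsion W (p : ℤ)) γ -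
            AddMonoidHom.id (Literature.NumberTheory.EllipticCurves.subgroupH1 κ.kerSubgroup
              (geomTorsion W (p : ℤ)))))^[J] y ≠ 0 →
          ∃ (Ψ : galoisCohomology (W.modPkTwist p (d + 1) κ.invTwist L) 1)
            (ψb : galoisCohomology (W.modPTwist p κ.invTwist L) 1),
            p ^ d • Ψ = galoisCohomology.map
              (κ.invTwist.twistModPToModPk (W.torsionGaloisModule (p : ℤ)) L
                (W.torsionGaloisModule ((p : ℤ) ^ (d + 1)))
                (fun P : geomTorsion W (p : ℤ) => AddSubgroup.torsionBy.nsmul P)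
                (W.pow_nsmul_geomTorsion_eq_zero p (d + 1)) ι) 1 ψb ∧
            (κ.invTwist.shiftH1 (W.torsionGaloisModule (p : ℤ))
                (fun P : geomTorsion W (p : ℤ) => AddSubgroup.torsionBy.nsmul P) L)^[J] ψb ≠ 0 ∧
            (∀ v : HeightOneSpectrum (𝓞 ℚ), v ∉ S →
              galoisCohomology.localization (W.modPkTwist p (d + 1) κ.invTwist L) (Sum.inr v) 1 Ψ ∈
                DiscreteGaloisModule.unramifiedSubgroup
                  (GaloisRep.toLocal v (W.modPkTwist p (d + 1) κ.invTwist L)) 1) ∧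
            (∀ v : HeightOneSpectrum (𝓞 ℚ), v ∈ S →
              galoisCohomology.localization (W.modPkTwist p (d + 1) κ.invTwist L) (Sum.inr v) 1
                (galoisCohomology.map
                  (κ.invTwist.twistModPkShiftEmbed (W.torsionGaloisModule ((p : ℤ) ^ (d + 1)))
                    (W.pow_nsmul_geomTorsion_eq_zero p (d + 1)) L (Nat.sub_le L ε)) 1
                  (galoisCohomology.map
                    (κ.invTwist.twistModPkTruncate (W.torsionGaloisModule ((p : ℤ) ^ (d + 1)))
                      (W.pow_nsmul_geomTorsion_eq_zero p (d + 1)) L (Nat.sub_le L ε)) 1 Ψ)) = 0) := by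
  intro W _ _ p _ κ γ hp2 hirr _ hκ hγ _ _ d ι hι S₀ hS₀
  have hp : p.Prime := Fact.out
  -- no `Γ_∞`-fixed `p`-torsion in `E[p^∞]` on X9 rows (`E[p]` irreducible, `p` odd, `ℚ_∞/ℚ` abelian)
  have hE : ∀ m : geomPrimaryTorsion W p, (∀ σ ∈ κ.kerSubgroup, σ • m = m) → p • m = 0 → m = 0 := by
    intro m hm hpm
    apply Subtype.ext
    exact Summit.BirchSwinnertonDyer.Rank1Residual.GaloisImage.geomPoints_eq_zero_of_fixed_of_pow_smul_eq_zero
      W p hp2 hirr (Abelianization.commutator_subset_ker _) (m : geomPoints W)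
      (fun σ hσ => congrArg Subtype.val (hm σ hσ)) 1
      (by rw [pow_one, ← AddSubgroupClass.coe_nsmul, hpm, ZeroMemClass.coe_zero])
  -- the finite set `S ⊇ S₀`: off `S`, `v ∤ p` and `E` has good reduction at `v`
  obtain ⟨S, hSfin, hS₀S, hSout⟩ :=
    TorsionUnramified.exists_finite_superset_isUnramifiedAt_torsionGaloisModule W hp.ne_zero hS₀
  -- the uniform exponent away from `p` and the exponent at `p`
  obtain ⟨εu, hεu⟩ :=
    exists_uniform_localization_shiftH1Pk_modPkTwist_invTwist_of_isCyclotomic_of_finite W p (d + 1) κ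
      hκ hSfin
  obtain ⟨Np, hNp⟩ := exists_localization_shiftH1Pk_iterate_eq_zero_of_mem W p (d + 1) κ hκ hγ
  refine ⟨max εu Np, S, hSfin, hS₀S, ?_⟩
  intro L J y hJL ht hyJ
  obtain ⟨t, hyt, htL⟩ := ht
  have hL : 0 < L := by omega
  have hlast : L - 1 < L := by omega
  -- the algebraic half: `ψ`, `ψ̄`, and the coordinate cocycles `e_i`
  obtain ⟨ψ, ψb, e, h1, h2, hcoord, he_rec, hψe⟩ :=
    exists_testCocycle_algebraic W p κ hγ hE d ι hι L J hJL y t hyt htL hyJ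
  -- every `ι_*[e_i] = (conj_γ − 1)^{L−1−i} t` is FINE
  have hfine : ∀ i : Fin L, resH1Hom (ContinuousMonoidHom.id κ.kerSubgroup)
      (AddSubgroup.inclusion (pkTorsion_le_geomPrimaryTorsion W p (d + 1))) (fun _ _ => rfl)
      (oneCocycleClass _ (e i)) ∈ W.fineSelmerInfty κ := fun i => by
    rw [hcoord i]
    exact iterate_sub_id_mem (W.conjH1 p κ.kerSubgroup γ) (W.fineSelmerInfty κ)
      (fun s hs => W.conjH1_mem_fineSelmerInfty κ γ hs) _ t.2
  -- the top coordinate class is `t`, so the bottom class `[γ·e_0 − e_0]` dies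
  have htopt : resH1Hom (ContinuousMonoidHom.id κ.kerSubgroup)
      (AddSubgroup.inclusion (pkTorsion_le_geomPrimaryTorsion W p (d + 1))) (fun _ _ => rfl)
      (oneCocycleClass _ (e ⟨L - 1, hlast⟩)) = (t : W.subgroupH1 p κ.kerSubgroup) := by
    have h := hcoord ⟨L - 1, hlast⟩
    have h0 : L - 1 - ((⟨L - 1, hlast⟩ : Fin L) : ℕ) = 0 := by simp
    rw [h0, Function.iterate_zero, id_eq] at h
    exact h
  have hbot : oneCocycleClass _ (conjCocycle κ.kerSubgroup γ (e ⟨0, hL⟩) - e ⟨0, hL⟩) = 0 :=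
    oneCocycleClass_conj_sub_eq_zero W p (d + 1) κ hE hL e he_rec (t : W.subgroupH1 p κ.kerSubgroup)
      htopt htL
  refine ⟨oneCocycleClass _ ψ, ψb, h1, h2, fun v hv => ?_, fun v hv => ?_⟩
  · -- (3) unramified off `S`: `ψ` vanishes on `I_{𝔓₀(v)} ≤ Γ_∞ ∩ D_v`
    obtain ⟨hpv, hgood, -⟩ := hSout v hv
    refine KolyvaginTwist.localization_mem_unramifiedSubgroup_of_forall_inertia_apply_eq_zero
      (W.modPkTwist p (d + 1) κ.invTwist L) v ψ fun τ hτ => ?_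
    have hτK : τ ∈ κ.kerSubgroup :=
      ZpExtension.inertia_le_kerSubgroup_holds ℚ p κ hpv (adicCompletionPrime_mem_primesAbove ℚ v) hτ
    funext i
    obtain ⟨a, ha⟩ := exists_root_of_mem_fineSelmerInfty W p (d + 1) κ (e i) (hfine i) v
    rw [Pi.zero_apply, show ψ.1 τ i = (e i).1 ⟨τ, hτK⟩ from hψe ⟨τ, hτK⟩ i]
    exact apply_eq_zero_of_mem_inertia W p (d + 1) κ hpv hgood (e i) ha hτ hτK
  · -- (4) `loc_v (T^ε Ψ) = 0` on `S`: the uniform exponent off `p`, the defect argument + engine at `p`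
    rw [map_twistModPkShiftEmbed_map_twistModPkTruncate_eq_shiftH1Pk_iterate]
    by_cases hpv : (p : 𝓞 ℚ) ∈ v.asIdeal
    · exact hNp v hpv L hL ψ e hψe he_rec
        (exists_root_of_mem_fineSelmerInfty W p (d + 1) κ (e ⟨L - 1, hlast⟩) (hfine _) v) hbot _
        (le_max_right _ _)
    · exact hεu (le_max_left _ _) v hv hpv L _

end Summit.BirchSwinnertonDyer.BirchSwinnertonDyer.Theorems.OneSidedTwistSqueezeX9KatoDivisibilityX9StubTestCocyclePkLevelX9

end
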